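import Literature.NumberTheory.Rogawski1990.ArchExplicitTransferFactorTauContinuous   -- ★ p835313 F3A: `isUnit_archTauArg_of_isUnit`; ★ `ArchExplicitTransferFactorRegular` (`isUnit_archGammaTwo`)
import Literature.NumberTheory.Rogawski1990.ExplicitFactorRationalLocalisation        -- ★ `rationalArch`, `coe_coe_cmRationalToArch`, `archGammaTwo_rationalArch`
import HarnessLib

/-!
# Rogawski's explicit ARCHIMEDEAN factor at the SCALAR PARTNER `γ_H = (e·1₂, u) ∈ H_∞`: `χ_g(u) = (u − e)²`, `τ_∞ = μ_∞(u)·μ_∞(−(u−e)²e⁻²)⁻¹`,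
# `D_{G∕H,∞} = Π_{w complex} |σ_w(u − e)|²` — the `H`-side of print's singular `γ₀ ⊗ 1 = diag(e, e, u)` (Rogawski (1990) §4.9 p. 55, Prop. 8.2.1 (a) p. 118)

Topic `NumberTheory/Rogawski1990`; namespace `Literature.NumberTheory.Rogawski1990`.  THEOREMS ONLY (no definition, no named fact, no instance, no notation,
no `sorry`; net debt 0).  Cell `pub/hodgecm-mathlib`, F0∕P3a, topic T6 (#88 side; road letter «D-S2∞», LEAD T6-71: the archimedean twin of ★ D-S2s
`FinExplicitTransferFactorScalarPartner` — the VALUES of ★ `archTau`, ★ `archWeylRatio` (typ-T6b N1a `ArchExplicitTransferFactor`) where the constants of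
the (κ-arch)∕(ST-∞-s) conjuncts of `S1′` are read).  Same idiom as ★ D-S2s: the scalar first block is the HYPOTHESIS `((γ_H.1 : GL₂(L ⊗ ℝ)) : matrix) = e • 1`.
Mathlib-only footing; count-neutral for the books.

THE MATHEMATICS (`L ⊗ ℝ = ℝ^{r₁} × ℂ^{r₂}`, `H_∞ = U(Φ₂)(L⁺⊗ℝ) × U(Φ₁)(L⁺⊗ℝ)`, `γ_H = (g, u)`, `g = e·1₂`).  `χ_g = (X − e)²`, `χ_g(u) = (u − e)²`, `det g = e²`,
`g⁻¹ = e⁻¹·1₂`, `(γ₂γ₁⁻¹ − 1)(1 − γ₂γ₃⁻¹) = −χ_g(u)·det g⁻¹ = −(u − e)²·e⁻²` (★ `archTauArg`), `τ_∞ = μ_∞(u)·μ_∞(−(u−e)²e⁻²)⁻¹` (★ `archTau`);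
`χ_g(u) ∈ (L⊗ℝ)ˣ ⟺ u − e ∈ (L⊗ℝ)ˣ` (the `(G,H)`-regularity guard of ★ F3A∕F3B∕F4, i.e. `σ_w(u) ≠ σ_w(e)` at every complex `w`); `D_{G∕H,∞}(γ_H) =
Π_w ‖σ_w(χ_g(u))‖ = Π_w ‖σ_w(u − e)‖²` (★ `archWeylRatio`; no square root at `∞`).  On a MATCHING pair `Δ″_∞ = τ_∞ · D_{G∕H,∞} · Π_w κ_w` with these values
substituted — the sign product `Π_w κ_w` is left symbolic (its value depends on `γ′` and on `w(H′)`, cf. ★ `ArchExplicitTransferFactorGHRegular` ∕ (P-γ)).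
For a RATIONAL `γ_H = (e₁·1₂, e₂) ∈ H(L⁺)` the archimedean image `γ_H ⊗ 1 = rationalArch γ_H` has scalar first block `(e₁ ⊗ 1)·1₂` (★ `coe_coe_cmRationalToArch`),
so all of §1 applies at `γ_H ⊗ 1` with `e = e₁ ⊗ 1`, `u = e₂ ⊗ 1`; the resulting `D_{G∕H,∞}(γ_H ⊗ 1) = Π_w ‖σ_w(e₂ − e₁)‖²` is ★ D-S2s's
`archWeylRatio_rationalArch_of_fst_eq_smul_one` (not restated here).

* §1 `archCharpolyTwo_of_fst_eq_smul_one`, **`eval_archCharpolyTwo_of_fst_eq_smul_one`**, `det_fst_arch_of_fst_eq_smul_one`,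
  `coe_inv_fst_arch_of_fst_eq_smul_one`, **`archTauArg_of_fst_eq_smul_one`**, **`archTau_of_fst_eq_smul_one`**, **`isUnit_eval_archCharpolyTwo_iff_of_fst_eq_smul_one`**,
  **`archWeylRatio_of_fst_eq_smul_one`**, `archExplicitDelta_of_fst_eq_smul_one` (matching pairs).
* §2 (rational) `coe_fst_rationalArch_of_fst_eq_smul_one`, **`archTau_rationalArch_of_fst_eq_smul_one`** (with ★ `archGammaTwo_rationalArch`),
  `isUnit_eval_archCharpolyTwo_rationalArch_iff_of_fst_eq_smul_one`.

EDITION LOG.  ED. 1 (★ p836443): §1–§2.  ED. 2 (this text, APPEND-ONLY, no import change): §3 — the archimedean projector at the scalar partner,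
`P_w((e·1₂,u), γ′) = (σ_w(γ′) − σ_w(e)·1₃)²` at every complex place `w` (★ `archEigenlineProjector`; the (κ-arch) letter's `κ_w = sgn Re tr(P_wᴴ H′_w P_w)·η_w`
then reads on `γ′` alone — ★ `archKappaSignAt`, ★ `ArchExplicitTransferFactorGHRegular`).

* §3 **`archEigenlineProjector_of_fst_eq_smul_one`**, `archEigenlineProjector_rationalArch_of_fst_eq_smul_one`.

HONEST LABEL: HC_CM is proved only modulo the printed citations (named inputs remaining 2) until rung 0 closes; this file proves none of them.

## References
* [Rogawski1990] J. D. Rogawski, *Automorphic Representations of Unitary Groups in Three Variables*, Ann. of Math. Stud. 123 (1990): §4.9 p. 55 (`τ`, `D_{G∕H}`),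
  Prop. 8.2.1 (a) p. 118 and the case `E∕F = ℂ∕ℝ` pp. 118–119, Lemma 14.5.2 (b) proof p. 238, §14.6 p. 242 (`Δ″_∞`).
-/

set_option autoImplicit false

noncomputable section

open NumberField InfinitePlace IsDedekindDomain Matrix Polynomial
open scoped MatrixGroups

namespace Literature.NumberTheory.Rogawski1990

open Literature.NumberTheory.Automorphic
open Literature.NumberTheory.GaloisRepresentations

/-! ## §1 The explicit archimedean factor at a scalar first block -/

section Local

variable (L : Type) [Field L] [NumberField L] [IsCMField L]
  (a : ↥(UnitaryGroup.arch (↥(maximalRealSubfield L)) L (IsCMField.complexConj L) 2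
      (Matrix.of fun i j : Fin 2 => if i.val + j.val + 1 = 2 then (1 : L) else 0)) ×
    ↥(UnitaryGroup.arch (↥(maximalRealSubfield L)) L (IsCMField.complexConj L) 1
      (Matrix.of fun i j : Fin 1 => if i.val + j.val + 1 = 1 then (1 : L) else 0)))
  {e : mixedEmbedding.mixedSpace L}
  (h : ((a.1 : GL (Fin 2) (mixedEmbedding.mixedSpace L)) : Matrix (Fin 2) (Fin 2) (mixedEmbedding.mixedSpace L)) =
    e • (1 : Matrix (Fin 2) (Fin 2) (mixedEmbedding.mixedSpace L)))

include h in
/-- **`χ_g = (X − e)²`** for the scalar block `g = e·1₂` of `H_∞`. [cite: Rogawski1990, §4.9 p. 55] -/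
theorem archCharpolyTwo_of_fst_eq_smul_one : archCharpolyTwo L a = (X - C e) ^ 2 := by
  unfold archCharpolyTwo
  rw [h, Matrix.charpoly_fin_two]
  simp only [Matrix.trace_fin_two, Matrix.det_fin_two, Matrix.smul_apply, Matrix.one_apply_eq,
    Matrix.one_apply_ne (by decide : (0 : Fin 2) ≠ 1), Matrix.one_apply_ne (by decide : (1 : Fin 2) ≠ 0), smul_eq_mul, mul_one, mul_zero, sub_zero,
    map_add, map_mul]
  ring

include h in
/-- **`χ_g(u) = (u − e)²`** at the archimedean scalar partner. [cite: Rogawski1990, §4.9 p. 55; Prop. 8.2.1 (a) p. 118] -/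
theorem eval_archCharpolyTwo_of_fst_eq_smul_one :
    (archCharpolyTwo L a).eval (archGammaTwo L a) = (archGammaTwo L a - e) ^ 2 := by
  rw [archCharpolyTwo_of_fst_eq_smul_one L a h]
  simp only [eval_pow, eval_sub, eval_X, eval_C]

include h in
/-- `det g = e²` (print's `γ₁γ₃`). [cite: Rogawski1990, §4.9 p. 55] -/
theorem det_fst_arch_of_fst_eq_smul_one :
    ((a.1 : GL (Fin 2) (mixedEmbedding.mixedSpace L)) : Matrix (Fin 2) (Fin 2) (mixedEmbedding.mixedSpace L)).det = e ^ 2 := by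
  rw [h, Matrix.det_smul, Matrix.det_one, mul_one, Fintype.card_fin]

include h in
/-- `e` is a unit of `L ⊗ ℝ` (`e² = det g`; the `L ⊗ ℝ` twin of ★ D-S2s `isUnit_of_fst_eq_smul_one`). [cite: Rogawski1990, §4.9 p. 55] -/
private theorem isUnit_of_fst_arch_eq_smul_one : IsUnit e := by
  have hd : IsUnit ((a.1 : GL (Fin 2) (mixedEmbedding.mixedSpace L)) : Matrix (Fin 2) (Fin 2) (mixedEmbedding.mixedSpace L)).det :=
    Matrix.isUnits_det_units _
  rw [det_fst_arch_of_fst_eq_smul_one L a h] at hd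
  exact (isUnit_pow_iff two_ne_zero).1 hd

include h in
/-- `e · e⁻¹ = 1` (coordinatewise inverse in `L ⊗ ℝ = ℝ^{r₁} × ℂ^{r₂}`). [folklore] -/
private theorem mul_inv_of_fst_arch_eq_smul_one : e * e⁻¹ = 1 := by
  have hu := isUnit_of_fst_arch_eq_smul_one L a h
  rw [Prod.isUnit_iff, Pi.isUnit_iff, Pi.isUnit_iff] at hu
  refine Prod.ext (funext fun v => mul_inv_cancel₀ (hu.1 v).ne_zero) (funext fun w => mul_inv_cancel₀ (hu.2 w).ne_zero)

include h in
/-- `g⁻¹ = e⁻¹·1₂` (print's `γ₁⁻¹ = γ₃⁻¹ = e⁻¹`). [cite: Rogawski1990, §4.9 p. 55] -/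
theorem coe_inv_fst_arch_of_fst_eq_smul_one :
    (((a.1 : GL (Fin 2) (mixedEmbedding.mixedSpace L))⁻¹ : GL (Fin 2) (mixedEmbedding.mixedSpace L)) :
        Matrix (Fin 2) (Fin 2) (mixedEmbedding.mixedSpace L)) = e⁻¹ • (1 : Matrix (Fin 2) (Fin 2) (mixedEmbedding.mixedSpace L)) := by
  have hmul : ((a.1 : GL (Fin 2) (mixedEmbedding.mixedSpace L)) : Matrix (Fin 2) (Fin 2) (mixedEmbedding.mixedSpace L)) *
      (e⁻¹ • (1 : Matrix (Fin 2) (Fin 2) _)) = 1 := by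
    rw [h, Matrix.smul_mul, Matrix.one_mul, smul_smul, mul_inv_of_fst_arch_eq_smul_one L a h, one_smul]
  calc (((a.1 : GL (Fin 2) (mixedEmbedding.mixedSpace L))⁻¹ : GL (Fin 2) (mixedEmbedding.mixedSpace L)) :
          Matrix (Fin 2) (Fin 2) (mixedEmbedding.mixedSpace L))
      = (((a.1 : GL (Fin 2) (mixedEmbedding.mixedSpace L))⁻¹ : GL (Fin 2) (mixedEmbedding.mixedSpace L)) : Matrix (Fin 2) (Fin 2) _) *
          (((a.1 : GL (Fin 2) (mixedEmbedding.mixedSpace L)) : Matrix (Fin 2) (Fin 2) (mixedEmbedding.mixedSpace L)) * (e⁻¹ • 1)) := by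
        rw [hmul, Matrix.mul_one]
    _ = e⁻¹ • (1 : Matrix (Fin 2) (Fin 2) _) := by
        rw [← Matrix.mul_assoc, ← Units.val_mul, inv_mul_cancel, Units.val_one, Matrix.one_mul]

include h in
/-- **`(γ₂γ₁⁻¹ − 1)(1 − γ₂γ₃⁻¹) = −(u − e)²·e⁻²`** at `∞` (★ `archTauArg = −χ_g(u)·det g⁻¹`). [cite: Rogawski1990, §4.9 p. 55] -/
theorem archTauArg_of_fst_eq_smul_one : archTauArg L a = -((archGammaTwo L a - e) ^ 2) * (e ^ 2)⁻¹ := by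
  unfold archTauArg
  rw [eval_archCharpolyTwo_of_fst_eq_smul_one L a h, coe_inv_fst_arch_of_fst_eq_smul_one L a h, Matrix.det_smul, Matrix.det_one, mul_one,
    Fintype.card_fin, inv_pow]

include h in
/-- **`τ_∞(γ_H) = μ_∞(u) · μ_∞(−(u − e)²·e⁻²)⁻¹`** at the archimedean scalar partner (unfolding ★ `archTau`). [cite: Rogawski1990, §4.9 p. 55] -/
theorem archTau_of_fst_eq_smul_one (μ : HeckeCharacter L) :
    archTau L a μ = archHeckeValue L μ (archGammaTwo L a) * (archHeckeValue L μ (-((archGammaTwo L a - e) ^ 2) * (e ^ 2)⁻¹))⁻¹ := by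
  unfold archTau
  rw [archTauArg_of_fst_eq_smul_one L a h]

include h in
/-- **`(G,H)`-REGULARITY OF THE SCALAR PARTNER AT `∞`: `χ_g(u) ∈ (L⊗ℝ)ˣ ⟺ u − e ∈ (L⊗ℝ)ˣ`** (`σ_w(u) ≠ σ_w(e)` at every complex place).
[cite: Rogawski1990, Prop. 8.2.1 (a) p. 118; §4.9 p. 55] -/
theorem isUnit_eval_archCharpolyTwo_iff_of_fst_eq_smul_one :
    IsUnit ((archCharpolyTwo L a).eval (archGammaTwo L a)) ↔ IsUnit (archGammaTwo L a - e) := by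
  rw [eval_archCharpolyTwo_of_fst_eq_smul_one L a h]
  exact isUnit_pow_iff two_ne_zero

include h in
open scoped Classical in
/-- **`D_{G∕H,∞}(γ_H) = Π_{w complex} ‖σ_w(u − e)‖²`** at the archimedean scalar partner (★ `archWeylRatio = Π_w ‖σ_w(χ_g(u))‖`, `σ_w = evalC w`).
[cite: Rogawski1990, §4.9 p. 55; Prop. 8.2.1 (a) p. 118] -/
theorem archWeylRatio_of_fst_eq_smul_one :
    archWeylRatio L a = ∏ w : {w : InfinitePlace L // IsComplex w}, ‖UnitaryGroup.evalC L w (archGammaTwo L a - e)‖ ^ 2 := by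
  unfold archWeylRatio
  rw [eval_archCharpolyTwo_of_fst_eq_smul_one L a h]
  exact Finset.prod_congr rfl fun w _ => by rw [map_pow, norm_pow]

variable (H' : Matrix (Fin 3) (Fin 3) L)

include h in
open scoped Classical in
/-- **`Δ″_∞(γ_H, γ′) = μ_∞(u)·μ_∞(−(u−e)²e⁻²)⁻¹ · Π_w ‖σ_w(u − e)‖² · Π_w κ_w(γ_H, γ′)`** on a MATCHING pair at the scalar partner (★ `archExplicitDelta_of_isArchNormPair`;
the sign product is left symbolic — its value depends on `γ′` and `w(H′)`, ★ `ArchExplicitTransferFactorGHRegular`). [cite: Rogawski1990, §14.6 p. 242; §4.9 p. 55; Prop. 8.2.1 (a) p. 118] -/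
theorem archExplicitDelta_of_fst_eq_smul_one (μ : HeckeCharacter L)
    {b : ↥(UnitaryGroup.arch (↥(maximalRealSubfield L)) L (IsCMField.complexConj L) 3 H')} (hb : IsArchNormPair L H' a b) :
    archExplicitDelta L H' a μ b =
      archHeckeValue L μ (archGammaTwo L a) * (archHeckeValue L μ (-((archGammaTwo L a - e) ^ 2) * (e ^ 2)⁻¹))⁻¹ *
        ((∏ w : {w : InfinitePlace L // IsComplex w}, ‖UnitaryGroup.evalC L w (archGammaTwo L a - e)‖ ^ 2 : ℝ) : ℂ) *
        ((∏ w : {w : InfinitePlace L // IsComplex w}, archKappaAt L H' a w b : ℤ) : ℂ) := by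
  rw [archExplicitDelta_of_isArchNormPair L H' a μ hb, archTau_of_fst_eq_smul_one L a h, archWeylRatio_of_fst_eq_smul_one L a h]

end Local

/-! ## §2 The rational singular partner `γ_H = (e₁·1₂, e₂)` at `∞` -/

section Rational

variable (L : Type) [Field L] [NumberField L] [IsCMField L]
  (γH : (UnitaryGroup.cmDatum L 2 (Matrix.of fun i j : Fin 2 => if i.val + j.val + 1 = 2 then (1 : L) else 0)).Rational ×
    (UnitaryGroup.cmDatum L 1 (Matrix.of fun i j : Fin 1 => if i.val + j.val + 1 = 1 then (1 : L) else 0)).Rational)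
  {e₁ : L} (h : (γH.1.val.val : Matrix (Fin 2) (Fin 2) L) = e₁ • (1 : Matrix (Fin 2) (Fin 2) L))

include h in
/-- **`γ_H ⊗ 1` has scalar first block `(e₁ ⊗ 1)·1₂`** (★ `coe_coe_cmRationalToArch`: the archimedean matrix is the entrywise `mixedEmbedding`). [cite: Rogawski1990, §4.9 p. 55] -/
theorem coe_fst_rationalArch_of_fst_eq_smul_one :
    (((rationalArch L γH).1 : GL (Fin 2) (mixedEmbedding.mixedSpace L)) : Matrix (Fin 2) (Fin 2) (mixedEmbedding.mixedSpace L)) =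
      mixedEmbedding L e₁ • (1 : Matrix (Fin 2) (Fin 2) (mixedEmbedding.mixedSpace L)) := by
  unfold rationalArch
  simp only []
  rw [coe_coe_cmRationalToArch, h]
  refine Matrix.ext fun i j => ?_
  simp only [Matrix.map_apply, Matrix.smul_apply, smul_eq_mul]
  by_cases hij : i = j
  · subst hij; simp
  · simp [Matrix.one_apply_ne hij]

include h in
/-- **`τ_∞(γ_H ⊗ 1) = μ_∞(e₂ ⊗ 1) · μ_∞((−(e₂ − e₁)²·e₁⁻²) ⊗ 1)⁻¹`** for the rational scalar partner. [cite: Rogawski1990, §4.9 p. 55; Prop. 8.2.1 (a) p. 118] -/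
theorem archTau_rationalArch_of_fst_eq_smul_one (μ : HeckeCharacter L) :
    archTau L (rationalArch L γH) μ =
      archHeckeValue L μ (mixedEmbedding L ((γH.2.val.val : Matrix (Fin 1) (Fin 1) L) 0 0)) *
        (archHeckeValue L μ (-((mixedEmbedding L ((γH.2.val.val : Matrix (Fin 1) (Fin 1) L) 0 0) - mixedEmbedding L e₁) ^ 2) *
          (mixedEmbedding L e₁ ^ 2)⁻¹))⁻¹ := by
  rw [archTau_of_fst_eq_smul_one L (rationalArch L γH) (coe_fst_rationalArch_of_fst_eq_smul_one L γH h) μ, archGammaTwo_rationalArch]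

include h in
/-- **`χ_g(u) ⊗ 1` is a unit iff `(e₂ − e₁) ⊗ 1` is** — i.e. iff `e₂ ≠ e₁` (a CM field is totally complex; ★ D-S2s `eval_charpoly_ne_zero_iff_of_fst_eq_smul_one_rational`).
[cite: Rogawski1990, Prop. 8.2.1 (a) p. 118] -/
theorem isUnit_eval_archCharpolyTwo_rationalArch_iff_of_fst_eq_smul_one :
    IsUnit ((archCharpolyTwo L (rationalArch L γH)).eval (archGammaTwo L (rationalArch L γH))) ↔
      IsUnit (mixedEmbedding L (((γH.2.val.val : Matrix (Fin 1) (Fin 1) L) 0 0) - e₁)) := by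
  rw [isUnit_eval_archCharpolyTwo_iff_of_fst_eq_smul_one L (rationalArch L γH) (coe_fst_rationalArch_of_fst_eq_smul_one L γH h),
    archGammaTwo_rationalArch, map_sub]

end Rational

/-! ## §3 (ED. 2) The archimedean projector at the scalar partner -/

section Projector

variable (L : Type) [Field L] [NumberField L] [IsCMField L] (H' : Matrix (Fin 3) (Fin 3) L)
  (a : ↥(UnitaryGroup.arch (↥(maximalRealSubfield L)) L (IsCMField.complexConj L) 2
      (Matrix.of fun i j : Fin 2 => if i.val + j.val + 1 = 2 then (1 : L) else 0)) ×
    ↥(UnitaryGroup.arch (↥(maximalRealSubfield L)) L (IsCMField.complexConj L) 1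
      (Matrix.of fun i j : Fin 1 => if i.val + j.val + 1 = 1 then (1 : L) else 0)))
  {e : mixedEmbedding.mixedSpace L}
  (h : ((a.1 : GL (Fin 2) (mixedEmbedding.mixedSpace L)) : Matrix (Fin 2) (Fin 2) (mixedEmbedding.mixedSpace L)) = e • (1 : Matrix (Fin 2) (Fin 2) (mixedEmbedding.mixedSpace L)))
  (w : {w : InfinitePlace L // IsComplex w})
  (γ' : ↥(UnitaryGroup.arch (↥(maximalRealSubfield L)) L (IsCMField.complexConj L) 3 H'))

include h in
/-- **`P_w((e·1₂, u), γ′) = (σ_w(γ′) − σ_w(e)·1₃)²`** at every complex place `w` — `χ_{σ_w(e)·1₂}(σ_w γ′) = σ_wγ′² − 2σ_w(e)·σ_wγ′ + σ_w(e)²·1`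
(★ `archEigenlineProjector`). [cite: Rogawski1990, §4.9 p. 55; §3.5 Prop. 3.5.2 (c) p. 29] -/
theorem archEigenlineProjector_of_fst_eq_smul_one :
    archEigenlineProjector L H' a w γ' =
      (((γ' : GL (Fin 3) (mixedEmbedding.mixedSpace L)) : Matrix (Fin 3) (Fin 3) (mixedEmbedding.mixedSpace L)).map (UnitaryGroup.evalC L w) - UnitaryGroup.evalC L w e • (1 : Matrix (Fin 3) (Fin 3) ℂ)) ^ 2 := by
  have hg : (((a.1 : GL (Fin 2) (mixedEmbedding.mixedSpace L)) : Matrix (Fin 2) (Fin 2) (mixedEmbedding.mixedSpace L)).map (UnitaryGroup.evalC L w)) =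
      UnitaryGroup.evalC L w e • (1 : Matrix (Fin 2) (Fin 2) ℂ) := by
    rw [h]
    refine Matrix.ext fun i j => ?_
    simp only [Matrix.map_apply, Matrix.smul_apply, smul_eq_mul]
    by_cases hij : i = j
    · subst hij; simp
    · simp [Matrix.one_apply_ne hij]
  change (((γ' : GL (Fin 3) (mixedEmbedding.mixedSpace L)) : Matrix (Fin 3) (Fin 3) (mixedEmbedding.mixedSpace L)).map (UnitaryGroup.evalC L w)) * (((γ' : GL (Fin 3) (mixedEmbedding.mixedSpace L)) : Matrix (Fin 3) (Fin 3) (mixedEmbedding.mixedSpace L)).map (UnitaryGroup.evalC L w)) -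
      ((((a.1 : GL (Fin 2) (mixedEmbedding.mixedSpace L)) : Matrix (Fin 2) (Fin 2) (mixedEmbedding.mixedSpace L)).map (UnitaryGroup.evalC L w))).trace •
        (((γ' : GL (Fin 3) (mixedEmbedding.mixedSpace L)) : Matrix (Fin 3) (Fin 3) (mixedEmbedding.mixedSpace L)).map (UnitaryGroup.evalC L w)) +
      ((((a.1 : GL (Fin 2) (mixedEmbedding.mixedSpace L)) : Matrix (Fin 2) (Fin 2) (mixedEmbedding.mixedSpace L)).map (UnitaryGroup.evalC L w))).det • (1 : Matrix (Fin 3) (Fin 3) ℂ) = _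
  rw [hg, Matrix.trace_smul, Matrix.trace_one, Matrix.det_smul, Matrix.det_one, mul_one, Fintype.card_fin]
  have hR : ((((γ' : GL (Fin 3) (mixedEmbedding.mixedSpace L)) : Matrix (Fin 3) (Fin 3) (mixedEmbedding.mixedSpace L)).map (UnitaryGroup.evalC L w)) - UnitaryGroup.evalC L w e • (1 : Matrix (Fin 3) (Fin 3) ℂ)) ^ 2 =
      (((γ' : GL (Fin 3) (mixedEmbedding.mixedSpace L)) : Matrix (Fin 3) (Fin 3) (mixedEmbedding.mixedSpace L)).map (UnitaryGroup.evalC L w)) * (((γ' : GL (Fin 3) (mixedEmbedding.mixedSpace L)) : Matrix (Fin 3) (Fin 3) (mixedEmbedding.mixedSpace L)).map (UnitaryGroup.evalC L w)) -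
        UnitaryGroup.evalC L w e • (((γ' : GL (Fin 3) (mixedEmbedding.mixedSpace L)) : Matrix (Fin 3) (Fin 3) (mixedEmbedding.mixedSpace L)).map (UnitaryGroup.evalC L w)) -
        UnitaryGroup.evalC L w e • (((γ' : GL (Fin 3) (mixedEmbedding.mixedSpace L)) : Matrix (Fin 3) (Fin 3) (mixedEmbedding.mixedSpace L)).map (UnitaryGroup.evalC L w)) +
        (UnitaryGroup.evalC L w e * UnitaryGroup.evalC L w e) • (1 : Matrix (Fin 3) (Fin 3) ℂ) := by
    simp only [sq, sub_mul, mul_sub, Matrix.smul_mul, Matrix.mul_smul, Matrix.one_mul, Matrix.mul_one, smul_smul]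
    abel
  rw [hR]
  simp only [smul_eq_mul, Nat.cast_ofNat]
  module

end Projector

section ProjectorRational

variable (L : Type) [Field L] [NumberField L] [IsCMField L] (H' : Matrix (Fin 3) (Fin 3) L)
  (γH : (UnitaryGroup.cmDatum L 2 (Matrix.of fun i j : Fin 2 => if i.val + j.val + 1 = 2 then (1 : L) else 0)).Rational ×
    (UnitaryGroup.cmDatum L 1 (Matrix.of fun i j : Fin 1 => if i.val + j.val + 1 = 1 then (1 : L) else 0)).Rational)
  {e₁ : L} (h : (γH.1.val.val : Matrix (Fin 2) (Fin 2) L) = e₁ • (1 : Matrix (Fin 2) (Fin 2) L))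
  (w : {w : InfinitePlace L // IsComplex w})
  (γ' : ↥(UnitaryGroup.arch (↥(maximalRealSubfield L)) L (IsCMField.complexConj L) 3 H'))

include h in
/-- **`P_w(γ_H ⊗ 1, γ′) = (σ_w(γ′) − σ_w(e₁)·1₃)²`** for the rational scalar partner `γ_H = (e₁·1₂, e₂)` (`σ_w(e₁ ⊗ 1) = σ_w(e₁)`, ★ `evalC_apply` ∘
`mixedEmbedding`). [cite: Rogawski1990, §4.9 p. 55; §14.6 p. 242] -/
theorem archEigenlineProjector_rationalArch_of_fst_eq_smul_one :
    archEigenlineProjector L H' (rationalArch L γH) w γ' =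
      (((γ' : GL (Fin 3) (mixedEmbedding.mixedSpace L)) : Matrix (Fin 3) (Fin 3) (mixedEmbedding.mixedSpace L)).map (UnitaryGroup.evalC L w) - (w.1.embedding e₁) • (1 : Matrix (Fin 3) (Fin 3) ℂ)) ^ 2 := by
  rw [archEigenlineProjector_of_fst_eq_smul_one L H' (rationalArch L γH) (coe_fst_rationalArch_of_fst_eq_smul_one L γH h) w γ',
    UnitaryGroup.evalC_apply, mixedEmbedding.mixedEmbedding_apply_isComplex]

end ProjectorRational

end Literature.NumberTheory.Rogawski1990

end
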